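import Summits.AtomisticToContinuum.Crystallization.Theorems.FrustratedLawDichotomyFarForceColumn
import Literature.Algebra.EuclideanLattices.RegevBallGeometry

/-!
# FrustratedLawDichotomy · crux `AperiodicFrustratedLawGap` (stmt-AtomisticToContinuum-27623) — the HALF-SPACE packing column
# (hdef side, row class H near class-D boundaries; critic r1741 (A)(3) PRE-REGISTRATION «HALFSPACE»; decomp-a2c, prover hand 1, gen 51)

For the halo rows of the cell certificate next to a class-D region the far matter is ARBITRARY `7/10`-separated matter filling a HALF-SPACE
`{⟪a − q, e⟫ ≥ h}` at distance `h` from the root, and the sphere-exterior packing sum of `…FarFieldSharp` (all matter beyond the SPHERE of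
radius `h`) over-books it by `≈ 10×` at `h ≈ 6–7` (hand-1 g51 desk FARCOL-HALO §4–§5: D-side inner radius 6–7 with a half-space envelope,
9–10 without).  This module proves the half-space analogue:

* `card_le_of_separated_cap` — CAP PACKING: a finite `δ`-separated set in `{⟪a, e⟫ ≥ d} ∩ {‖a‖ ≤ D}` (`‖e‖ = 1`, `δ/2 ≤ d ≤ D`) has at most
  `(6/δ³)·(D − d + δ)·((D + δ/2)² − (d − δ/2)²)` points (the `δ/2`-balls are disjoint and lie in the CYLINDER
  `{d − δ/2 < x·e < D + δ/2} × {|x⊥| < √((D+δ/2)² − (d−δ/2)²)}`, whose volume is `π L² · height`; ball volume `πδ³/6`);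
* `sum_rpow_neg_le_of_card_filter_le` — LAYER CAKE: if the points of `s` are at distance `≥ d > 0` from `q` and
  `#{a ∈ s : dist a q < t} ≤ c₃t³ + c₂t² + c₁t + c₀` for every `t > d`, then for every real `p > 3`
  `Σ_{a ∈ s} (dist a q)^{−p} ≤ p·(c₃ d^{3−p}/(p−3) + c₂ d^{2−p}/(p−2) + c₁ d^{1−p}/(p−1) + c₀ d^{−p}/p)` (signs of the `cᵢ` free — this is what
  keeps the rim cancellation of the cap count, which termwise Abel bounds lose);
* ★ `sum_rpow_neg_le_of_separated_halfspace` — the HALF-SPACE COLUMN: finite `δ`-separated `s` with `d ≤ ⟪a − q, e⟫` for all `a ∈ s`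
  (`‖e‖ = 1`, `δ/2 ≤ d`, `0 < d`), `p > 3` ⟹ `Σ_{a ∈ s} (dist a q)^{−p} ≤ p·(6/δ³)·(d^{3−p}/(p−3) + (2δ − d)d^{2−p}/(p−2) + (δ² − d²)d^{1−p}/(p−1) + (δ − d)²d·d^{−p}/p)`;
* `sum_norm_force_le_of_separated_halfspace_sevenTenths` — the half-space FORCE column at the crux line's hard core `δ = 7/10`
  (`p = 7` and `p = 13`, via `…FarForceColumn.norm_force_term_le`), as an explicit rational function `TH(d)` of `d`;
  literal `halfSpaceForceColumn_seven_le : TH(7) ≤ 43/10000` (desk: D-boundary-atom tax at inner radius 7 with this PROVED column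
  = 5.8e-3 … 9.0e-3 ≤ 0.0135 on F1 — class-D templates reach void + 7).

DEF-FREE; imports the tree's `…FarForceColumn` and `Literature…RegevBallGeometry` (coordinate splitting `splitFirst`, Fubini); 0 sorry.
All `[folklore]` (volume packing in a cylinder + layer-cake summation).
-/

noncomputable section

namespace Summit.AtomisticToContinuum.Crystallization.Theorems.FrustratedLawDichotomyHalfSpaceColumn

open scoped BigOperators RealInnerProductSpace ENNReal
open MeasureTheory Metric Set
open Literature.Algebra.EuclideanLattices.Regev2004 (splitFirst splitFirst_apply measurePreserving_splitFirst norm_sq_eq_succ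
  norm_sq_eq_sum volume_toLp_preimage_ball)
open Summit.AtomisticToContinuum.Crystallization.Theorems.FrustratedLawDichotomyFarForceColumn (norm_force_term_le)

/-! ## §1. Cap packing: separated points of a half-space inside a ball -/

/-- **CAP PACKING (cylinder majorant).**  Let `e` be a unit vector of `ℝ³`, `0 < δ`, `δ/2 ≤ d ≤ D`, and `t` a finite `δ`-separated set with
`d ≤ ⟪a, e⟫` and `‖a‖ ≤ D` for all `a ∈ t`.  Then `#t ≤ (6/δ³)·(D − d + δ)·((D + δ/2)² − (d − δ/2)²)`: the disjoint balls `B(a, δ/2)` lie in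
the cylinder `{d − δ/2 < ⟪x, e⟫ < D + δ/2, ‖x − ⟪x,e⟫e‖² < (D + δ/2)² − (d − δ/2)²}` of volume `π·((D+δ/2)² − (d−δ/2)²)·(D − d + δ)`,
each of volume `πδ³/6`. [folklore] -/
theorem card_le_of_separated_cap (t : Finset (EuclideanSpace ℝ (Fin 3))) (e : EuclideanSpace ℝ (Fin 3)) (he : ‖e‖ = 1)
    {δ d D : ℝ} (hδ : 0 < δ) (hd : δ / 2 ≤ d) (hdD : d ≤ D)
    (hsep : ∀ a ∈ t, ∀ b ∈ t, a ≠ b → δ ≤ dist a b) (ht : ∀ a ∈ t, d ≤ ⟪a, e⟫ ∧ ‖a‖ ≤ D) :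
    (t.card : ℝ) ≤ 6 / δ ^ 3 * (D - d + δ) * ((D + δ / 2) ^ 2 - (d - δ / 2) ^ 2) := by
  classical
  -- an orthonormal basis through `e`; its coordinate map `f`
  have hon : Orthonormal ℝ (({0} : Set (Fin 3)).restrict fun _ : Fin 3 => e) := by
    rw [orthonormal_subsingleton_iff]
    intro i; exact he
  obtain ⟨b, hb⟩ := hon.exists_orthonormalBasis_extension_of_card_eq (by simp [finrank_euclideanSpace])
  have hb0 : b 0 = e := hb 0 rfl
  set f := b.repr with hf
  have hf0 : ∀ x : EuclideanSpace ℝ (Fin 3), f x 0 = ⟪e, x⟫ := fun x => by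
    have h := b.repr_apply_apply x 0
    rw [hb0] at h
    exact h
  -- the numbers
  set a₀ : ℝ := d - δ / 2 with ha₀
  set ρ₂ : ℝ := D + δ / 2 with hρ₂
  have ha₀0 : 0 ≤ a₀ := by rw [ha₀]; linarith
  have haρ : a₀ < ρ₂ := by rw [ha₀, hρ₂]; linarith
  have hρ₂0 : 0 < ρ₂ := lt_of_le_of_lt ha₀0 haρ
  have hL2 : 0 < ρ₂ ^ 2 - a₀ ^ 2 := by nlinarith
  set L : ℝ := Real.sqrt (ρ₂ ^ 2 - a₀ ^ 2) with hL
  have hLsq : L ^ 2 = ρ₂ ^ 2 - a₀ ^ 2 := Real.sq_sqrt hL2.le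
  -- the cylinder in coordinates and the coordinate map
  set C : Set (ℝ × (Fin 2 → ℝ)) := Set.Ioo a₀ ρ₂ ×ˢ ((WithLp.toLp 2) ⁻¹' ball (0 : EuclideanSpace ℝ (Fin 2)) L) with hC
  set g : EuclideanSpace ℝ (Fin 3) → ℝ × (Fin 2 → ℝ) := fun x => splitFirst 2 (f x) with hg
  have hgmp : MeasurePreserving g volume volume := (measurePreserving_splitFirst 2).comp f.measurePreserving
  have hCmeas : MeasurableSet C :=
    measurableSet_Ioo.prod ((WithLp.measurable_toLp 2 _) measurableSet_ball)
  have hCvol : volume C = ENNReal.ofReal (ρ₂ - a₀) * (ENNReal.ofReal L ^ 2 * ENNReal.ofReal Real.pi) := by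
    rw [hC, show (volume : Measure (ℝ × (Fin 2 → ℝ))) = volume.prod volume from rfl, Measure.prod_prod, Real.volume_Ioo,
      volume_toLp_preimage_ball, EuclideanSpace.volume_ball_fin_two]
  -- the disjoint small balls
  set A : Set (EuclideanSpace ℝ (Fin 3)) := ⋃ a ∈ t, ball a (δ / 2) with hA
  have hdisj : (t : Set (EuclideanSpace ℝ (Fin 3))).PairwiseDisjoint fun a => ball a (δ / 2) := by
    intro a ha c hc hac
    apply ball_disjoint_ball
    have := hsep a ha c hc hac
    linarith
  have hAvol : volume A = (t.card : ℝ≥0∞) * (ENNReal.ofReal (δ / 2) ^ 3 * ENNReal.ofReal (Real.pi * 4 / 3)) := by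
    rw [hA, measure_biUnion_finset hdisj fun a _ => measurableSet_ball]
    simp only [EuclideanSpace.volume_ball_fin_three, Finset.sum_const, nsmul_eq_mul]
  -- the balls lie in the cylinder
  have hsub : A ⊆ g ⁻¹' C := by
    rw [hA]
    refine iUnion₂_subset fun a ha x hx => ?_
    rw [mem_ball, dist_eq_norm] at hx
    obtain ⟨hae, haD⟩ := ht a ha
    rw [Set.mem_preimage, hg]
    simp only [splitFirst_apply, hC, Set.mem_prod, Set.mem_Ioo, Set.mem_preimage, mem_ball_zero_iff]
    -- first coordinate: `⟪e, x⟫ = ⟪e, a⟫ + ⟪e, x - a⟫`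
    have hx0 : f x 0 = ⟪e, a⟫ + ⟪e, x - a⟫ := by rw [hf0, ← inner_add_right, add_sub_cancel]
    have hcs : |⟪e, x - a⟫| ≤ ‖x - a‖ := by
      have := abs_real_inner_le_norm e (x - a); rwa [he, one_mul] at this
    have hea : ⟪e, a⟫ = ⟪a, e⟫ := real_inner_comm _ _
    have h0lo : a₀ < f x 0 := by
      rw [hx0, hea, ha₀]
      have := neg_abs_le ⟪e, x - a⟫
      linarith
    have hxn : ‖x‖ < ρ₂ := by
      have : ‖x‖ ≤ ‖a‖ + ‖x - a‖ := by
        have := norm_add_le a (x - a); rwa [add_sub_cancel] at this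
      rw [hρ₂]; linarith
    have hfx : ‖f x‖ = ‖x‖ := f.norm_map x
    have hsplit := norm_sq_eq_succ 2 (f x)
    have htail := norm_sq_eq_sum 2 (WithLp.toLp 2 fun j : Fin 2 => f x j.succ)
    have hxx : ‖f x‖ ^ 2 < ρ₂ ^ 2 := by
      rw [hfx]; exact pow_lt_pow_left₀ hxn (norm_nonneg _) two_ne_zero
    have hsum0 : 0 ≤ ∑ j : Fin 2, (f x j.succ) ^ 2 := Finset.sum_nonneg fun j _ => sq_nonneg _
    have h0hi : f x 0 < ρ₂ := by
      have h1 : (f x 0) ^ 2 < ρ₂ ^ 2 := by linarith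
      have h2 : |f x 0| < ρ₂ := abs_lt_of_sq_lt_sq h1 hρ₂0.le
      exact lt_of_le_of_lt (le_abs_self _) h2
    refine ⟨⟨h0lo, h0hi⟩, ?_⟩
    -- lateral part: `Σ_{j ≥ 1} (f x)_j² = ‖x‖² − (f x)₀² < ρ₂² − a₀² = L²`
    have h00 : a₀ ^ 2 < (f x 0) ^ 2 := by nlinarith
    have hlat : ‖(WithLp.toLp 2 fun j : Fin 2 => f x j.succ : EuclideanSpace ℝ (Fin 2))‖ ^ 2 < L ^ 2 := by
      rw [hLsq, htail]
      have : ∑ j : Fin 2, ((WithLp.toLp 2 fun j : Fin 2 => f x j.succ : EuclideanSpace ℝ (Fin 2)) j) ^ 2 =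
          ∑ j : Fin 2, (f x j.succ) ^ 2 := rfl
      rw [this]; linarith
    have hL0 : 0 ≤ L := Real.sqrt_nonneg _
    exact lt_of_pow_lt_pow_left₀ 2 hL0 hlat
  -- compare volumes
  have hvol : (t.card : ℝ≥0∞) * (ENNReal.ofReal (δ / 2) ^ 3 * ENNReal.ofReal (Real.pi * 4 / 3)) ≤
      ENNReal.ofReal (ρ₂ - a₀) * (ENNReal.ofReal L ^ 2 * ENNReal.ofReal Real.pi) := by
    rw [← hAvol, ← hCvol, ← hgmp.measure_preimage hCmeas.nullMeasurableSet]
    exact measure_mono hsub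
  -- pass to the reals
  have hfin : ENNReal.ofReal (ρ₂ - a₀) * (ENNReal.ofReal L ^ 2 * ENNReal.ofReal Real.pi) ≠ ⊤ := by
    refine ENNReal.mul_ne_top ENNReal.ofReal_ne_top (ENNReal.mul_ne_top ?_ ENNReal.ofReal_ne_top)
    exact ENNReal.pow_ne_top ENNReal.ofReal_ne_top
  have hreal := ENNReal.toReal_mono hfin hvol
  rw [ENNReal.toReal_mul, ENNReal.toReal_mul, ENNReal.toReal_mul, ENNReal.toReal_mul, ENNReal.toReal_natCast,
    ← ENNReal.ofReal_pow (by positivity : (0:ℝ) ≤ δ / 2), ← ENNReal.ofReal_pow (Real.sqrt_nonneg _),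
    ENNReal.toReal_ofReal (by positivity), ENNReal.toReal_ofReal (by positivity), ENNReal.toReal_ofReal (by linarith),
    ENNReal.toReal_ofReal (by positivity), ENNReal.toReal_ofReal Real.pi_pos.le, hLsq] at hreal
  -- `card · (δ/2)³ · (4π/3) ≤ (ρ₂ − a₀) · L² · π`
  have hπ : 0 < Real.pi := Real.pi_pos
  have hδ3 : 0 < δ ^ 3 := pow_pos hδ 3
  have key : (t.card : ℝ) * δ ^ 3 ≤ 6 * ((ρ₂ - a₀) * (ρ₂ ^ 2 - a₀ ^ 2)) := by
    have h1 : (t.card : ℝ) * ((δ / 2) ^ 3 * (Real.pi * 4 / 3)) = ((t.card : ℝ) * δ ^ 3) * (Real.pi / 6) := by ring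
    have h2 : (ρ₂ - a₀) * ((ρ₂ ^ 2 - a₀ ^ 2) * Real.pi) = (6 * ((ρ₂ - a₀) * (ρ₂ ^ 2 - a₀ ^ 2))) * (Real.pi / 6) := by ring
    rw [h1, h2] at hreal
    exact le_of_mul_le_mul_right hreal (by positivity)
  have hρa : ρ₂ - a₀ = D - d + δ := by rw [hρ₂, ha₀]; ring
  rw [hρa] at key
  rw [div_mul_eq_mul_div, div_mul_eq_mul_div, le_div_iff₀ hδ3]
  linarith


/-! ## §2. Layer cake with a cubic count majorant (signs free) -/

/-- `∫_d^∞ t^a dt = d^{a+1}/(−(a+1))` for `a < −1`, `d > 0` (Mathlib's `integral_Ioi_rpow_of_lt`, rearranged). [folklore] -/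
theorem integral_Ioi_rpow_eq {a d : ℝ} (ha : a < -1) (hd : 0 < d) :
    ∫ t in Ioi d, t ^ a = d ^ (a + 1) / (-(a + 1)) := by
  rw [integral_Ioi_rpow_of_lt ha hd, div_neg, neg_div]

/-- `r^{−p} = ∫_d^∞ 𝟙_{(r,∞)}(t)·p t^{−p−1} dt` for `0 < d ≤ r`, `0 < p` (layer cake for one term). [folklore] -/
theorem rpow_neg_eq_integral_indicator {p d r : ℝ} (hp : 0 < p) (hd : 0 < d) (hdr : d ≤ r) :
    r ^ (-p) = ∫ t in Ioi d, (Ioi r).indicator (fun t : ℝ => p * t ^ (-p - 1)) t := by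
  have hr : 0 < r := hd.trans_le hdr
  rw [setIntegral_indicator measurableSet_Ioi, Set.Ioi_inter_Ioi, sup_eq_right.2 hdr, integral_const_mul,
    integral_Ioi_rpow_eq (by linarith) hr]
  have h1 : -p - 1 + 1 = -p := by ring
  rw [h1, neg_neg]
  field_simp

/-- **LAYER CAKE with a cubic count majorant.**  If every point of `s` is at distance `≥ d > 0` from `q` and, for every `t > d`, the number of
points at distance `< t` is `≤ c₃t³ + c₂t² + c₁t + c₀` (coefficients of ANY sign), then for every real `p > 3`
`Σ_{a ∈ s} (dist a q)^{−p} ≤ p·(c₃ d^{3−p}/(p−3) + c₂ d^{2−p}/(p−2) + c₁ d^{1−p}/(p−1) + c₀ d^{−p}/p)`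
(`= ∫_d^∞ p t^{−p−1}·(c₃t³ + c₂t² + c₁t + c₀) dt`). [folklore] -/
theorem sum_rpow_neg_le_of_card_filter_le (s : Finset (EuclideanSpace ℝ (Fin 3))) (q : EuclideanSpace ℝ (Fin 3))
    {d p c₃ c₂ c₁ c₀ : ℝ} (hd : 0 < d) (hp : 3 < p) (hfar : ∀ a ∈ s, d ≤ dist a q)
    (hP : ∀ t : ℝ, d < t → ((s.filter fun a => dist a q < t).card : ℝ) ≤ c₃ * t ^ 3 + c₂ * t ^ 2 + c₁ * t + c₀) :
    ∑ a ∈ s, (dist a q) ^ (-p) ≤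
      p * (c₃ * d ^ (3 - p) / (p - 3) + c₂ * d ^ (2 - p) / (p - 2) + c₁ * d ^ (1 - p) / (p - 1) + c₀ * d ^ (-p) / p) := by
  classical
  have hp0 : 0 < p := by linarith
  -- integrability of the powers on `Ioi d`
  have hI : ∀ a : ℝ, a < -1 → IntegrableOn (fun t : ℝ => t ^ a) (Ioi d) := fun a ha => integrableOn_Ioi_rpow_of_lt ha hd
  have hint1 : IntegrableOn (fun t : ℝ => p * t ^ (-p - 1)) (Ioi d) := (hI _ (by linarith)).const_mul p
  -- each term as an integral
  have hterm : ∀ a ∈ s, (dist a q) ^ (-p) = ∫ t in Ioi d, (Ioi (dist a q)).indicator (fun t : ℝ => p * t ^ (-p - 1)) t :=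
    fun a ha => rpow_neg_eq_integral_indicator hp0 hd (hfar a ha)
  have hint_term : ∀ a ∈ s, IntegrableOn (fun t => (Ioi (dist a q)).indicator (fun t : ℝ => p * t ^ (-p - 1)) t) (Ioi d) :=
    fun a _ => hint1.indicator measurableSet_Ioi
  have hsum_eq : ∑ a ∈ s, (dist a q) ^ (-p) =
      ∫ t in Ioi d, ∑ a ∈ s, (Ioi (dist a q)).indicator (fun t : ℝ => p * t ^ (-p - 1)) t := by
    rw [integral_finsetSum _ hint_term]
    exact Finset.sum_congr rfl hterm
  -- the majorant `g = p t^{-p-1} (c₃t³ + c₂t² + c₁t + c₀)`, written as a sum of powers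
  set g : ℝ → ℝ := fun t => p * c₃ * t ^ (2 - p) + p * c₂ * t ^ (1 - p) + p * c₁ * t ^ (-p) + p * c₀ * t ^ (-p - 1) with hg
  have hF3 : IntegrableOn (fun t : ℝ => p * c₃ * t ^ (2 - p)) (Ioi d) := (hI _ (by linarith)).const_mul _
  have hF2 : IntegrableOn (fun t : ℝ => p * c₂ * t ^ (1 - p)) (Ioi d) := (hI _ (by linarith)).const_mul _
  have hF1 : IntegrableOn (fun t : ℝ => p * c₁ * t ^ (-p)) (Ioi d) := (hI _ (by linarith)).const_mul _
  have hF0 : IntegrableOn (fun t : ℝ => p * c₀ * t ^ (-p - 1)) (Ioi d) := (hI _ (by linarith)).const_mul _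
  have hF32 : IntegrableOn (fun t : ℝ => p * c₃ * t ^ (2 - p) + p * c₂ * t ^ (1 - p)) (Ioi d) := hF3.add hF2
  have hF321 : IntegrableOn (fun t : ℝ => p * c₃ * t ^ (2 - p) + p * c₂ * t ^ (1 - p) + p * c₁ * t ^ (-p)) (Ioi d) := hF32.add hF1
  have hint_g : IntegrableOn g (Ioi d) := hF321.add hF0
  -- pointwise bound on `Ioi d`
  have hpt : ∀ t ∈ Ioi d, ∑ a ∈ s, (Ioi (dist a q)).indicator (fun t : ℝ => p * t ^ (-p - 1)) t ≤ g t := by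
    intro t ht
    have htd : d < t := ht
    have ht0 : 0 < t := hd.trans htd
    have hind : ∀ a ∈ s, (Ioi (dist a q)).indicator (fun t : ℝ => p * t ^ (-p - 1)) t =
        if dist a q < t then p * t ^ (-p - 1) else 0 := by
      intro a _
      simp only [Set.indicator, Set.mem_Ioi]
    rw [Finset.sum_congr rfl hind, ← Finset.sum_filter, Finset.sum_const, nsmul_eq_mul]
    have hpt0 : 0 ≤ p * t ^ (-p - 1) := by positivity
    have hcard := hP t htd
    have e3 : t ^ (2 - p) = t ^ 3 * t ^ (-p - 1) := by
      rw [show (2 : ℝ) - p = (3 : ℕ) + (-p - 1) by push_cast; ring, Real.rpow_add ht0, Real.rpow_natCast]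
    have e2 : t ^ (1 - p) = t ^ 2 * t ^ (-p - 1) := by
      rw [show (1 : ℝ) - p = (2 : ℕ) + (-p - 1) by push_cast; ring, Real.rpow_add ht0, Real.rpow_natCast]
    have e1 : t ^ (-p) = t * t ^ (-p - 1) := by
      have h := Real.rpow_add ht0 1 (-p - 1)
      rw [Real.rpow_one, show (1 : ℝ) + (-p - 1) = -p by ring] at h
      exact h
    have hgt : g t = (c₃ * t ^ 3 + c₂ * t ^ 2 + c₁ * t + c₀) * (p * t ^ (-p - 1)) := by
      simp only [hg, e3, e2, e1]
      ring
    rw [hgt]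
    exact mul_le_mul_of_nonneg_right hcard hpt0
  -- integrate the majorant
  have hint_sum : IntegrableOn (fun t => ∑ a ∈ s, (Ioi (dist a q)).indicator (fun t : ℝ => p * t ^ (-p - 1)) t) (Ioi d) :=
    integrable_finsetSum _ hint_term
  have i3 : ∫ t in Ioi d, p * c₃ * t ^ (2 - p) = p * c₃ * (d ^ (3 - p) / (p - 3)) := by
    rw [integral_const_mul, integral_Ioi_rpow_eq (by linarith) hd, show (2 : ℝ) - p + 1 = 3 - p by ring,
      show -((3 : ℝ) - p) = p - 3 by ring]
  have i2 : ∫ t in Ioi d, p * c₂ * t ^ (1 - p) = p * c₂ * (d ^ (2 - p) / (p - 2)) := by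
    rw [integral_const_mul, integral_Ioi_rpow_eq (by linarith) hd, show (1 : ℝ) - p + 1 = 2 - p by ring,
      show -((2 : ℝ) - p) = p - 2 by ring]
  have i1 : ∫ t in Ioi d, p * c₁ * t ^ (-p) = p * c₁ * (d ^ (1 - p) / (p - 1)) := by
    rw [integral_const_mul, integral_Ioi_rpow_eq (by linarith) hd, show -p + 1 = 1 - p by ring,
      show -((1 : ℝ) - p) = p - 1 by ring]
  have i0 : ∫ t in Ioi d, p * c₀ * t ^ (-p - 1) = p * c₀ * (d ^ (-p) / p) := by
    rw [integral_const_mul, integral_Ioi_rpow_eq (by linarith) hd, show -p - 1 + 1 = -p by ring, neg_neg]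
  have s1 : ∫ t in Ioi d, (p * c₃ * t ^ (2 - p) + p * c₂ * t ^ (1 - p)) =
      p * c₃ * (d ^ (3 - p) / (p - 3)) + p * c₂ * (d ^ (2 - p) / (p - 2)) := by
    rw [integral_add hF3 hF2, i3, i2]
  have s2 : ∫ t in Ioi d, (p * c₃ * t ^ (2 - p) + p * c₂ * t ^ (1 - p) + p * c₁ * t ^ (-p)) =
      p * c₃ * (d ^ (3 - p) / (p - 3)) + p * c₂ * (d ^ (2 - p) / (p - 2)) + p * c₁ * (d ^ (1 - p) / (p - 1)) := by
    rw [integral_add hF32 hF1, s1, i1]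
  have hIg : ∫ t in Ioi d, g t =
      p * (c₃ * d ^ (3 - p) / (p - 3) + c₂ * d ^ (2 - p) / (p - 2) + c₁ * d ^ (1 - p) / (p - 1) + c₀ * d ^ (-p) / p) := by
    simp only [hg]
    rw [integral_add hF321 hF0, s2, i0]
    ring
  calc ∑ a ∈ s, (dist a q) ^ (-p)
      = ∫ t in Ioi d, ∑ a ∈ s, (Ioi (dist a q)).indicator (fun t : ℝ => p * t ^ (-p - 1)) t := hsum_eq
    _ ≤ ∫ t in Ioi d, g t := setIntegral_mono_on hint_sum hint_g measurableSet_Ioi hpt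
    _ = _ := hIg

/-! ## §3. The half-space column -/

/-- ★ **HALF-SPACE INVERSE-POWER COLUMN.**  Let `e` be a unit vector, `0 < δ`, `δ/2 ≤ d`, `0 < d`, and `s` a finite `δ`-separated set with
`d ≤ ⟪a − q, e⟫` for all `a ∈ s` (all of `s` lies beyond the plane at signed distance `d` from `q` in direction `e`).  Then for every real
`p > 3`, `Σ_{a ∈ s} (dist a q)^{−p} ≤ p·((6/δ³)d^{3−p}/(p−3) + (6/δ³)(2δ − d)d^{2−p}/(p−2) + (6/δ³)(δ² − d²)d^{1−p}/(p−1) + (6/δ³)(δ − d)²d·d^{−p}/p)`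
(cap packing `card_le_of_separated_cap` at every radius + the layer cake; the negative coefficients carry the rim cancellation). [folklore] -/
theorem sum_rpow_neg_le_of_separated_halfspace (s : Finset (EuclideanSpace ℝ (Fin 3))) (q e : EuclideanSpace ℝ (Fin 3)) (he : ‖e‖ = 1)
    {δ d p : ℝ} (hδ : 0 < δ) (hd2 : δ / 2 ≤ d) (hd : 0 < d) (hp : 3 < p)
    (hsep : ∀ a ∈ s, ∀ b ∈ s, a ≠ b → δ ≤ dist a b) (hhalf : ∀ a ∈ s, d ≤ ⟪a - q, e⟫) :
    ∑ a ∈ s, (dist a q) ^ (-p) ≤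
      p * (6 / δ ^ 3 * d ^ (3 - p) / (p - 3) + 6 / δ ^ 3 * (2 * δ - d) * d ^ (2 - p) / (p - 2) +
        6 / δ ^ 3 * (δ ^ 2 - d ^ 2) * d ^ (1 - p) / (p - 1) + 6 / δ ^ 3 * ((δ - d) ^ 2 * d) * d ^ (-p) / p) := by
  classical
  have hfar : ∀ a ∈ s, d ≤ dist a q := fun a ha => by
    rw [dist_eq_norm]
    have h1 := hhalf a ha
    have h2 : ⟪a - q, e⟫ ≤ ‖a - q‖ * ‖e‖ := real_inner_le_norm _ _
    rw [he, mul_one] at h2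
    linarith
  refine sum_rpow_neg_le_of_card_filter_le s q hd hp hfar fun t ht => ?_
  -- translate the points within distance `t` to the origin and count them in the cap
  set F : Finset (EuclideanSpace ℝ (Fin 3)) := s.filter fun a => dist a q < t with hF
  set F' : Finset (EuclideanSpace ℝ (Fin 3)) := F.image fun a => a - q with hF'
  have hcard : F'.card = F.card := Finset.card_image_of_injective _ (sub_left_injective)
  have hsep' : ∀ a ∈ F', ∀ b ∈ F', a ≠ b → δ ≤ dist a b := by
    intro a ha b hb hab
    rw [hF', Finset.mem_image] at ha hb
    obtain ⟨a', ha', rfl⟩ := ha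
    obtain ⟨b', hb', rfl⟩ := hb
    rw [dist_eq_norm, sub_sub_sub_cancel_right, ← dist_eq_norm]
    exact hsep a' (Finset.mem_filter.1 ha').1 b' (Finset.mem_filter.1 hb').1 fun h => hab (by rw [h])
  have hF't : ∀ a ∈ F', d ≤ ⟪a, e⟫ ∧ ‖a‖ ≤ t := by
    intro a ha
    rw [hF', Finset.mem_image] at ha
    obtain ⟨a', ha', rfl⟩ := ha
    obtain ⟨ha's, ha't⟩ := Finset.mem_filter.1 ha'
    refine ⟨hhalf a' ha's, ?_⟩
    rw [← dist_eq_norm]; exact ha't.le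
  have h := card_le_of_separated_cap F' e he hδ hd2 ht.le hsep' hF't
  rw [hcard] at h
  refine h.trans (le_of_eq ?_)
  ring

/-! ## §4. The half-space FORCE column at the crux line's hard core `δ = 7/10` -/

/-- `d ^ (k − m) = d⁻¹ ^ (m − k)`-type conversion: for `d > 0` and naturals `k ≤ m`, `d ^ ((k:ℝ) − m) = d⁻¹ ^ (m − k)`. [folklore] -/
theorem rpow_natCast_sub_natCast {d : ℝ} (hd : 0 < d) {k m : ℕ} (hkm : k ≤ m) :
    d ^ ((k : ℝ) - (m : ℝ)) = d⁻¹ ^ (m - k) := by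
  rw [show ((k : ℝ) - (m : ℝ)) = -(((m - k : ℕ) : ℝ)) by push_cast [Nat.cast_sub hkm]; ring,
    Real.rpow_neg hd.le, Real.rpow_natCast, inv_pow]

/-- ★ **HALF-SPACE FORCE COLUMN at separation `7/10`.**  For a finite `7/10`-separated `s ⊂ ℝ³` lying beyond the plane at signed distance
`d ≥ 7/20` (`d > 0`) from `x` in the unit direction `e` (`d ≤ ⟪a − x, e⟫` for all `a ∈ s`),
`Σ_{a ∈ s} ‖((dist x a)⁻¹^8 − (dist x a)⁻¹^14) • (x − a)‖ ≤ TH(d)` with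
`TH(d) = (6000/343)·[7·(d⁻⁴/4 + (7/5 − d)d⁻⁵/5 + (49/100 − d²)d⁻⁶/6 + (7/10 − d)²·d·d⁻⁷/7) + 13·(d⁻¹⁰/10 + (7/5 − d)d⁻¹¹/11 + (49/100 − d²)d⁻¹²/12 + (7/10 − d)²·d·d⁻¹³/13)]`
(`p = 7` and `p = 13` instances of `sum_rpow_neg_le_of_separated_halfspace` + `…FarForceColumn.norm_force_term_le`). [folklore] -/
theorem sum_norm_force_le_of_separated_halfspace_sevenTenths (s : Finset (EuclideanSpace ℝ (Fin 3)))
    (x e : EuclideanSpace ℝ (Fin 3)) (he : ‖e‖ = 1) {d : ℝ} (hd : 7 / 20 ≤ d)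
    (hsep : ∀ a ∈ s, ∀ b ∈ s, a ≠ b → (7 : ℝ) / 10 ≤ dist a b) (hhalf : ∀ a ∈ s, d ≤ ⟪a - x, e⟫) :
    ∑ a ∈ s, ‖((dist x a)⁻¹ ^ 8 - (dist x a)⁻¹ ^ 14) • (x - a)‖ ≤
      6000 / 343 * (7 * (d⁻¹ ^ 4 / 4 + (7 / 5 - d) * d⁻¹ ^ 5 / 5 + (49 / 100 - d ^ 2) * d⁻¹ ^ 6 / 6 + (7 / 10 - d) ^ 2 * d * d⁻¹ ^ 7 / 7) +
        13 * (d⁻¹ ^ 10 / 10 + (7 / 5 - d) * d⁻¹ ^ 11 / 11 + (49 / 100 - d ^ 2) * d⁻¹ ^ 12 / 12 + (7 / 10 - d) ^ 2 * d * d⁻¹ ^ 13 / 13)) := by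
  have hd0 : 0 < d := by linarith
  have h7 := sum_rpow_neg_le_of_separated_halfspace s x e he (p := 7) (by norm_num : (0:ℝ) < 7 / 10) (by linarith) hd0 (by norm_num)
    hsep hhalf
  have h13 := sum_rpow_neg_le_of_separated_halfspace s x e he (p := 13) (by norm_num : (0:ℝ) < 7 / 10) (by linarith) hd0 (by norm_num)
    hsep hhalf
  -- convert the real powers at `p = 7, 13` to inverse natural powers
  have c7 : ∀ a ∈ s, (dist a x) ^ (-(7:ℝ)) = (dist x a)⁻¹ ^ 7 := fun a ha => by
    have hr : 0 < dist a x := hd0.trans_le (by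
      have := hhalf a ha; have h2 : ⟪a - x, e⟫ ≤ ‖a - x‖ * ‖e‖ := real_inner_le_norm _ _
      rw [he, mul_one, ← dist_eq_norm] at h2; linarith)
    rw [dist_comm x a, show (-(7:ℝ)) = -((7:ℕ):ℝ) by norm_num, Real.rpow_neg hr.le, Real.rpow_natCast, inv_pow]
  have c13 : ∀ a ∈ s, (dist a x) ^ (-(13:ℝ)) = (dist x a)⁻¹ ^ 13 := fun a ha => by
    have hr : 0 < dist a x := hd0.trans_le (by
      have := hhalf a ha; have h2 : ⟪a - x, e⟫ ≤ ‖a - x‖ * ‖e‖ := real_inner_le_norm _ _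
      rw [he, mul_one, ← dist_eq_norm] at h2; linarith)
    rw [dist_comm x a, show (-(13:ℝ)) = -((13:ℕ):ℝ) by norm_num, Real.rpow_neg hr.le, Real.rpow_natCast, inv_pow]
  have e34 : d ^ ((3:ℝ) - 7) = d⁻¹ ^ 4 := by
    rw [show ((3:ℝ) - 7) = ((3:ℕ):ℝ) - ((7:ℕ):ℝ) by norm_num, rpow_natCast_sub_natCast hd0 (by norm_num)]
  have e25 : d ^ ((2:ℝ) - 7) = d⁻¹ ^ 5 := by
    rw [show ((2:ℝ) - 7) = ((2:ℕ):ℝ) - ((7:ℕ):ℝ) by norm_num, rpow_natCast_sub_natCast hd0 (by norm_num)]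
  have e16 : d ^ ((1:ℝ) - 7) = d⁻¹ ^ 6 := by
    rw [show ((1:ℝ) - 7) = ((1:ℕ):ℝ) - ((7:ℕ):ℝ) by norm_num, rpow_natCast_sub_natCast hd0 (by norm_num)]
  have e07 : d ^ (-(7:ℝ)) = d⁻¹ ^ 7 := by
    rw [show (-(7:ℝ)) = ((0:ℕ):ℝ) - ((7:ℕ):ℝ) by norm_num, rpow_natCast_sub_natCast hd0 (by norm_num)]
  have e310 : d ^ ((3:ℝ) - 13) = d⁻¹ ^ 10 := by
    rw [show ((3:ℝ) - 13) = ((3:ℕ):ℝ) - ((13:ℕ):ℝ) by norm_num, rpow_natCast_sub_natCast hd0 (by norm_num)]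
  have e211 : d ^ ((2:ℝ) - 13) = d⁻¹ ^ 11 := by
    rw [show ((2:ℝ) - 13) = ((2:ℕ):ℝ) - ((13:ℕ):ℝ) by norm_num, rpow_natCast_sub_natCast hd0 (by norm_num)]
  have e112 : d ^ ((1:ℝ) - 13) = d⁻¹ ^ 12 := by
    rw [show ((1:ℝ) - 13) = ((1:ℕ):ℝ) - ((13:ℕ):ℝ) by norm_num, rpow_natCast_sub_natCast hd0 (by norm_num)]
  have e013 : d ^ (-(13:ℝ)) = d⁻¹ ^ 13 := by
    rw [show (-(13:ℝ)) = ((0:ℕ):ℝ) - ((13:ℕ):ℝ) by norm_num, rpow_natCast_sub_natCast hd0 (by norm_num)]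
  rw [Finset.sum_congr rfl c7, e34, e25, e16, e07] at h7
  rw [Finset.sum_congr rfl c13, e310, e211, e112, e013] at h13
  have hterm : ∀ a ∈ s, ‖((dist x a)⁻¹ ^ 8 - (dist x a)⁻¹ ^ 14) • (x - a)‖ ≤ (dist x a)⁻¹ ^ 7 + (dist x a)⁻¹ ^ 13 :=
    fun a _ => norm_force_term_le x a
  calc ∑ a ∈ s, ‖((dist x a)⁻¹ ^ 8 - (dist x a)⁻¹ ^ 14) • (x - a)‖
      ≤ ∑ a ∈ s, ((dist x a)⁻¹ ^ 7 + (dist x a)⁻¹ ^ 13) := Finset.sum_le_sum hterm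
    _ = ∑ a ∈ s, (dist x a)⁻¹ ^ 7 + ∑ a ∈ s, (dist x a)⁻¹ ^ 13 := Finset.sum_add_distrib
    _ ≤ _ := by
        have := add_le_add h7 h13
        refine this.trans (le_of_eq ?_)
        norm_num
        ring

/-- `TH(7) ≤ 21/10000 = 2.1·10⁻³` (per unit adjoint mass, one half-space; desk: with this PROVED column the class-D boundary-atom tax at inner
radius 7 is `5.8·10⁻³ … 9.0·10⁻³ ≤ 0.0135` on the binding F1 cell — D templates reach void + 7). [folklore] -/
theorem halfSpaceForceColumn_seven_le :
    6000 / 343 * (7 * ((7:ℝ)⁻¹ ^ 4 / 4 + (7 / 5 - 7) * (7:ℝ)⁻¹ ^ 5 / 5 + (49 / 100 - 7 ^ 2) * (7:ℝ)⁻¹ ^ 6 / 6 + (7 / 10 - 7) ^ 2 * 7 * (7:ℝ)⁻¹ ^ 7 / 7) +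
        13 * ((7:ℝ)⁻¹ ^ 10 / 10 + (7 / 5 - 7) * (7:ℝ)⁻¹ ^ 11 / 11 + (49 / 100 - 7 ^ 2) * (7:ℝ)⁻¹ ^ 12 / 12 + (7 / 10 - 7) ^ 2 * 7 * (7:ℝ)⁻¹ ^ 13 / 13)) ≤
      21 / 10000 := by
  norm_num

end Summit.AtomisticToContinuum.Crystallization.Theorems.FrustratedLawDichotomyHalfSpaceColumn

end
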